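import Summits.BirchSwinnertonDyer.BirchSwinnertonDyer.Theorems.GenusKolyvaginAtTwoPowDvdShaCardAtTwoRTLevelRange
import Summits.BirchSwinnertonDyer.BirchSwinnertonDyer.Theorems.GenusKolyvaginAtTwoEquivariantKolyvaginExactAtTwoPropFourFourRat
import Literature.NumberTheory.EllipticCurves.CasselsTateSelmerKolyvaginValue
import HarnessLib

/-!
# Route `GenusKolyvaginAtTwo`, crux L_T `PowDvdShaCardAtTwoRT` (stmt-BirchSwinnertonDyer-23242), LINE 18 stub L, bottom rung:
# THE `hXs` AND `hℓ′` PRODUCERS — local orders of the descended class at the own primes, from the relation over `K`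

LEAD seat `bsd-line-gk2-p1` g16 (cell `bsd-f1-sign2`), `--supports 23242 --as helper`.  THEOREMS ONLY; no `sorry`; standard axioms.
BSD is NOT proved by any of this; neither is the crux nor stub L.

WHY (memo `Cruxes/PowDvdShaCardAtTwoRT/Lines/plus-descent-lead-g16.md` §2, §10).  The reciprocity step
`…RTBottomRungReciprocity.false_of_bottomRung` displays, besides `hX` (`…RTRelaxedDoublingKummer`) and `hL` (local typing at the deep own
primes), two inputs that come from the Kolyvagin RELATION over the Heegner field `K` (the route's Q2 `KolyvaginRelationAtTwo`, McCallum 1991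
Prop. 4.4) and the Čebotarev CHOICE of the primes (orders of localisations):
* `hXs` — at a FREE own prime `ℓ ∈ s` of the `k`-minimal primitive product `n`: `loc_ℓ (2•Z) = 0`, because `(n/ℓ)ℓ′` is imprimitive
  (`2 • c((n/ℓ)ℓ′) = 0` at level `4`) and Q2 at `λ ∣ ℓ` transports «`2 • c` vanishes at `λ`» from `(n/ℓ)ℓ′` to `nℓ′`;
* `hℓ′` — at the NEW deep prime `ℓ′`: `loc_{ℓ′} Z` has order `2^M` exactly and `⟨loc_{ℓ′} Z⟩ ∩ H¹_f = 0` (Q2 at `λ′ ∣ ℓ′` for `n ⊂ nℓ′`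
  plus the prescribed order `2^M` of `loc_{λ′} c(n)`), which is what `…RTDoubleKill.pairing_two_nsmul_ne_zero_of_lagrangian` consumes
  as `hmeet` / `hz`.
Both live over `K_λ`; the class `Z` lives over `ℚ_ℓ`.  The transport `ℚ_ℓ ⟷ K_λ` at a Gross–Kolyvagin prime is the tree's LINE 6
dictionary (`SelmerDescent.zsmul_mem_torsionLocalKer_iff_resTorsion_of_notMem`, `…zsmul_mem_selmerLocalKer_iff_resTorsion`), and the
passage «local kernel ⟷ localisation» is `mem_torsionLocalKer_iff_res_eq_zero` / `res_mem_kummerLocalConditionAt_iff`.  This file: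
* §1 `zsmul_eq_zero_of_zsmul_mem_of_pow_two` — pure algebra: if `2^j • z ∈ F ⟹ M ≤ j` and `2^M • z = 0` then `k • z ∈ F ⟹ k • z = 0`
  for EVERY `k : ℤ` (Bézout with `gcd(k, 2^M) = 2^i`);
* §2 over any number field: `zsmul_localization_eq_zero_of_mem_kummerSelmerStructure` (= `hmeet` at `ℓ′` from the `2`-power order
  data of `Z` at `v`), `zsmul_localization_ne_zero_of_notMem_torsionLocalKer` (= `hz`);
* §3 over `ℚ`, even depth (`res_K Z = c_K(nℓ′)`): **`bottomRung_newPrime_inputs_of_K`** — `hmeet ∧ hz` at `ℓ′` from Q2's two clauses at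
  `λ′` and the order clause of the Čebotarev choice; **`localization_two_nsmul_eq_zero_of_K`** — `hXs` at a free prime from Q2's second
  clause and `2 • c_K((n/ℓ)ℓ′) = 0`.  (Odd depth goes through the twin `E^{(d_K)}` and `hPsiKT`, `…PropFourFourRat`; same shape.)
Namespace `…Theorems.GenusExact.RelaxedCount`.  Closes nothing.  BSD is NOT proved by any of this.

References: [McCallumLMS1991] §4 Prop. 4.4, §5 Lemma 5.3 and proof of Prop. 5.2; [GrossLMS1991] Prop. 6.2; [SilvermanAEC2009] X.§4.
-/

set_option autoImplicit false
-- the Theorems namespace of this sub repeats the summit name by design (D-0017 nested layout)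
set_option linter.dupNamespace false

noncomputable section

open scoped Classical

open Field NumberField IsDedekindDomain Function WeierstrassCurve
open Literature.NumberTheory.EllipticCurves
open Literature.NumberTheory.GaloisRepresentations
open Summit.BirchSwinnertonDyer.BirchSwinnertonDyer.Theorems.GenusExact.SelmerDescent

namespace Summit.BirchSwinnertonDyer.BirchSwinnertonDyer.Theorems.GenusExact.RelaxedCount

/-! ## §1 Pure algebra: `2`-power order data control every integer multiple -/

section Algebra

variable {V : Type*} [AddCommGroup V]

/-- **If `2^j • z ∈ F` forces `M ≤ j` and `2^M • z = 0`, then every multiple `k • z` lying in `F` is zero.**  Bézout: `g = gcd(k, 2^M)`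
is a power `2^i` (`Nat.dvd_prime_pow`) with `g • z = a•(k•z) + b•(2^M•z) ∈ F`, so `M ≤ i`, `g = 2^M ∣ k`, and `k • z` is a multiple of
`2^M • z = 0`.  In the engine: `F = H¹_f(ℚ_{ℓ′}, E[2^M])`, `z = loc_{ℓ′} Z` — the hypothesis `hmeet` of
`pairing_two_nsmul_ne_zero_of_lagrangian`. [cite: McCallumLMS1991, §5 Lemma 5.3] -/
theorem zsmul_eq_zero_of_zsmul_mem_of_pow_two (F : AddSubgroup V) {z : V} {M : ℕ}
    (hS : ∀ j : ℕ, ((2 ^ j : ℕ) : ℤ) • z ∈ F → M ≤ j) (hT : ((2 ^ M : ℕ) : ℤ) • z = 0) (k : ℤ) (hk : k • z ∈ F) :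
    k • z = 0 := by
  set g : ℕ := Int.gcd k ((2 ^ M : ℕ) : ℤ) with hg
  have hgdvd : g ∣ 2 ^ M := by
    have h := Int.gcd_dvd_right k ((2 ^ M : ℕ) : ℤ)
    exact_mod_cast h
  obtain ⟨i, hiM, hgi⟩ := (Nat.dvd_prime_pow Nat.prime_two).mp hgdvd
  have hgz : (g : ℤ) • z ∈ F := by
    rw [hg, Int.gcd_eq_gcd_ab, add_smul, mul_comm k, mul_smul, mul_comm ((2 ^ M : ℕ) : ℤ), mul_smul, hT, smul_zero,
      add_zero]
    exact F.zsmul_mem hk _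
  have hMi : M ≤ i := hS i (by rw [← hgi]; exact hgz)
  have hiM' : i = M := le_antisymm hiM hMi
  have hgM : (g : ℤ) = ((2 ^ M : ℕ) : ℤ) := by rw [hgi, hiM']
  obtain ⟨c, hc⟩ : (g : ℤ) ∣ k := Int.gcd_dvd_left k _
  rw [hc, mul_comm, mul_smul, hgM, hT, smul_zero]

end Algebra

/-! ## §2 Over a number field: local kernels ⟷ localisations -/

section Local

variable {K : Type} [Field K] [NumberField K] (W : WeierstrassCurve K) [W.IsElliptic]

/-- **`hmeet` at a finite place from `2`-power order data.**  For `Z ∈ H¹(K, E[q])` and a finite place `v`: if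
`2^j • Z ∈ selmerLocalKer_v ⟹ M ≤ j` and `2^M • Z ∈ torsionLocalKer_v` (i.e. `loc_v (2^M Z) = 0`), then every multiple
`k • loc_v Z` lying in the Kummer group `𝓛_v` vanishes.  (`res_mem_kummerLocalConditionAt_iff`, `mem_torsionLocalKer_iff_res_eq_zero`,
§1.) [cite: McCallumLMS1991, §5 Lemma 5.3] -/
theorem zsmul_localization_eq_zero_of_mem_kummerSelmerStructure (q : ℕ) [NeZero q] {M : ℕ} (v : HeightOneSpectrum (𝓞 K))
    (Z : galoisCohomology (W.torsionGaloisModule (q : ℤ)) 1)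
    (hS : ∀ j : ℕ, ((2 ^ j : ℕ) : ℤ) • Z ∈ selmerLocalKer W (v.adicCompletion K) (q : ℤ) → M ≤ j)
    (hT : ((2 ^ M : ℕ) : ℤ) • Z ∈ W.torsionLocalKer (v.adicCompletion K) (q : ℤ)) (k : ℤ)
    (hk : k • galoisCohomology.localization (W.torsionGaloisModule (q : ℤ)) (Sum.inr v) 1 Z ∈
      W.kummerSelmerStructure (q : ℤ) (Sum.inr v : Place K)) :
    k • galoisCohomology.localization (W.torsionGaloisModule (q : ℤ)) (Sum.inr v) 1 Z = 0 := by
  haveI : CharZero (v.adicCompletion K) := charZero_of_injective_algebraMap (algebraMap K (v.adicCompletion K)).injective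
  refine zsmul_eq_zero_of_zsmul_mem_of_pow_two (W.kummerSelmerStructure (q : ℤ) (Sum.inr v : Place K))
    (fun j hj ↦ hS j ?_) ?_ k hk
  · rw [← map_zsmul] at hj
    exact (res_mem_kummerLocalConditionAt_iff W (q : ℤ) (Place.Completion (Sum.inr v : Place K)) _).mp hj
  · rw [← map_zsmul]
    exact (mem_torsionLocalKer_iff_res_eq_zero W (v.adicCompletion K) (NeZero.ne q) _).mp hT

/-- **`hz` at a finite place**: `c • Z ∉ torsionLocalKer_v ⟹ c • loc_v Z ≠ 0`. [cite: McCallumLMS1991, §3 (3)] -/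
theorem zsmul_localization_ne_zero_of_notMem_torsionLocalKer (q : ℕ) [NeZero q] (v : HeightOneSpectrum (𝓞 K))
    (Z : galoisCohomology (W.torsionGaloisModule (q : ℤ)) 1) (c : ℤ)
    (hN : c • Z ∉ W.torsionLocalKer (v.adicCompletion K) (q : ℤ)) :
    c • galoisCohomology.localization (W.torsionGaloisModule (q : ℤ)) (Sum.inr v) 1 Z ≠ 0 := by
  haveI : CharZero (v.adicCompletion K) := charZero_of_injective_algebraMap (algebraMap K (v.adicCompletion K)).injective
  intro h0
  rw [← map_zsmul] at h0
  exact hN ((mem_torsionLocalKer_iff_res_eq_zero W (v.adicCompletion K) (NeZero.ne q) _).mpr h0)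

/-- **`hXs`-shape at a finite place**: `c • Z ∈ torsionLocalKer_v ⟹ loc_v (c • Z) = 0`. [cite: McCallumLMS1991, §3 (3)] -/
theorem localization_zsmul_eq_zero_of_mem_torsionLocalKer (q : ℕ) [NeZero q] (v : HeightOneSpectrum (𝓞 K))
    (Z : galoisCohomology (W.torsionGaloisModule (q : ℤ)) 1) (c : ℤ)
    (h : c • Z ∈ W.torsionLocalKer (v.adicCompletion K) (q : ℤ)) :
    galoisCohomology.localization (W.torsionGaloisModule (q : ℤ)) (Sum.inr v) 1 (c • Z) = 0 := by
  haveI : CharZero (v.adicCompletion K) := charZero_of_injective_algebraMap (algebraMap K (v.adicCompletion K)).injective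
  exact (mem_torsionLocalKer_iff_res_eq_zero W (v.adicCompletion K) (NeZero.ne q) _).mp h

end Local

/-! ## §3 Over `ℚ`, even depth: the inputs at `ℓ′` and at a free prime from the relation over `K` -/

section Rat

variable (W : WeierstrassCurve ℚ) [W.IsElliptic] {K : Type} [Field K] [NumberField K]

/-- **The `ℓ′`-inputs of the bottom rung from Q2 and the Čebotarev choice (even depth).**  Data: `Δ(E) < 0`, `q = 2^M`, `M ≥ 1`; the
new prime `ℓ′ = ℓ` odd, in `v`, good, `ℓ ∤ c` (`K = ℚ(θ)`, `θ² = c`), `Frob_ℓ ∼ τ` on `E[q]`, `w ∣ v` inert; `Z ∈ H¹(ℚ, E[q])` with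
`res_K Z = c_K′ = c_K(nℓ′)` and `c_K = c_K(n)`.  Hypotheses: `hRel` = Q2 at `w` (both clauses, all `j`), `hOrd` = the order clause of
`EquivariantChebotarevAtTwoR` for `c_K(n)` at `w` with prescribed exponent `M` («`2^j c_K(n)` vanishes at `λ′` iff `M ≤ j`»).
Conclusion: `hmeet` — every multiple of `loc_{ℓ′} Z` in `H¹_f` vanishes — and `hz` — `2^(M-1) • loc_{ℓ′} Z ≠ 0` (for `M = 2`: `2 • loc Z ≠ 0`).
[cite: McCallumLMS1991, §4 Prop. 4.4 and §5 proof of Prop. 5.2] [cite: GrossLMS1991, Prop. 6.2] -/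
theorem bottomRung_newPrime_inputs_of_K (hΔ : W.Δ < 0) {M : ℕ} (hM : 1 ≤ M) {q : ℕ} (hq : q = 2 ^ M) [NeZero q]
    {ℓ : ℕ} (hℓ : ℓ.Prime) (hℓ2 : ℓ ≠ 2) {v : HeightOneSpectrum (𝓞 ℚ)} (hℓv : (ℓ : 𝓞 ℚ) ∈ v.asIdeal)
    (hgood : W.HasGoodReductionAt v) (h2K : Module.finrank ℚ K = 2) {θ : K} (hθ : θ ∉ (algebraMap ℚ K).range) {c : ℤ}
    (hc : θ ^ 2 = algebraMap ℚ K c) (hcv : ((c : ℤ) : 𝓞 ℚ) ∉ v.asIdeal) (hℓM : FrobEqFrobInfty W K q ℓ)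
    (w : HeightOneSpectrum (𝓞 K)) [w.asIdeal.LiesOver v.asIdeal] (hf : w.asIdeal.inertiaDeg (𝓞 ℚ) = 2)
    {Z : galoisCohomology (W.torsionGaloisModule (q : ℤ)) 1} {cK cK' : galH1Torsion (W.baseChange K) (q : ℤ)}
    (hZ : resTorsion W K (q : ℤ) Z = cK')
    (hRel : ∀ j : ℕ,
      (((2 ^ j : ℕ) : ℤ) • cK' ∈ selmerLocalKer (W.baseChange K) (w.adicCompletion K) (q : ℤ) ↔
        ((2 ^ j : ℕ) : ℤ) • cK' ∈ (W.baseChange K).torsionLocalKer (w.adicCompletion K) (q : ℤ)) ∧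
      (((2 ^ j : ℕ) : ℤ) • cK' ∈ (W.baseChange K).torsionLocalKer (w.adicCompletion K) (q : ℤ) ↔
        ((2 ^ j : ℕ) : ℤ) • cK ∈ (W.baseChange K).torsionLocalKer (w.adicCompletion K) (q : ℤ)))
    (hOrd : ∀ j : ℕ, ((2 ^ j : ℕ) : ℤ) • cK ∈ (W.baseChange K).torsionLocalKer (w.adicCompletion K) (q : ℤ) ↔ M ≤ j) :
    (∀ k : ℤ, k • galoisCohomology.localization (W.torsionGaloisModule (q : ℤ)) (Sum.inr v) 1 Z ∈
        W.kummerSelmerStructure (q : ℤ) (Sum.inr v : Place ℚ) →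
      k • galoisCohomology.localization (W.torsionGaloisModule (q : ℤ)) (Sum.inr v) 1 Z = 0) ∧
    ((2 ^ (M - 1) : ℕ) : ℤ) • galoisCohomology.localization (W.torsionGaloisModule (q : ℤ)) (Sum.inr v) 1 Z ≠ 0 := by
  obtain ⟨h2v, hqv⟩ := two_notMem_and_natCast_two_pow_notMem hq hℓ hℓ2 hℓv
  -- the dictionary at the Gross–Kolyvagin prime `ℓ`
  have hdT : ∀ c' : ℤ, c' • Z ∈ W.torsionLocalKer (v.adicCompletion ℚ) (q : ℤ) ↔
      c' • cK' ∈ (W.baseChange K).torsionLocalKer (w.adicCompletion K) (q : ℤ) := fun c' ↦ by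
    rw [← hZ]
    exact zsmul_mem_torsionLocalKer_iff_resTorsion_of_notMem W hΔ hM hq hℓ hℓ2 hℓv hgood h2K hθ hc hcv hℓM w hf Z c'
  have hdS : ∀ c' : ℤ, c' • Z ∈ selmerLocalKer W (v.adicCompletion ℚ) (q : ℤ) ↔
      c' • cK' ∈ selmerLocalKer (W.baseChange K) (w.adicCompletion K) (q : ℤ) := fun c' ↦ by
    rw [← hZ]
    exact zsmul_mem_selmerLocalKer_iff_resTorsion W h2K hθ hc (q : ℤ) v w hgood hqv h2v hcv Z c'
  have hS : ∀ j : ℕ, ((2 ^ j : ℕ) : ℤ) • Z ∈ selmerLocalKer W (v.adicCompletion ℚ) (q : ℤ) → M ≤ j := fun j hj ↦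
    (hOrd j).mp ((hRel j).2.mp ((hRel j).1.mp ((hdS _).mp hj)))
  have hT : ((2 ^ M : ℕ) : ℤ) • Z ∈ W.torsionLocalKer (v.adicCompletion ℚ) (q : ℤ) :=
    (hdT _).mpr ((hRel M).2.mpr ((hOrd M).mpr le_rfl))
  refine ⟨zsmul_localization_eq_zero_of_mem_kummerSelmerStructure W q v Z hS hT, ?_⟩
  refine zsmul_localization_ne_zero_of_notMem_torsionLocalKer W q v Z _ fun hN ↦ ?_
  have hle : M ≤ M - 1 := (hOrd (M - 1)).mp ((hRel (M - 1)).2.mp ((hdT _).mp hN))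
  omega

/-- **`hXs` at a free own prime from Q2 (even depth).**  Data as above at the free prime `ℓ ∈ s` (inert `w ∣ v`); `res_K Z = c_K′ = c_K(nℓ′)`
and `c_K = c_K((n/ℓ)ℓ′)` with `2 • c_K = 0` (the product `(n/ℓ)ℓ′` is imprimitive: `k`-minimality of `n`).  Q2's clauses at `w` for `j = 1`
give «`2 • c_K′` vanishes at `w`», the dictionary moves it to `ℚ_ℓ`: `loc_ℓ (2 • Z) = 0`. [cite: McCallumLMS1991, §4 Prop. 4.4] -/
theorem localization_two_nsmul_eq_zero_of_K (hΔ : W.Δ < 0) {M : ℕ} (hM : 1 ≤ M) {q : ℕ} (hq : q = 2 ^ M) [NeZero q]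
    {ℓ : ℕ} (hℓ : ℓ.Prime) (hℓ2 : ℓ ≠ 2) {v : HeightOneSpectrum (𝓞 ℚ)} (hℓv : (ℓ : 𝓞 ℚ) ∈ v.asIdeal)
    (hgood : W.HasGoodReductionAt v) (h2K : Module.finrank ℚ K = 2) {θ : K} (hθ : θ ∉ (algebraMap ℚ K).range) {c : ℤ}
    (hc : θ ^ 2 = algebraMap ℚ K c) (hcv : ((c : ℤ) : 𝓞 ℚ) ∉ v.asIdeal) (hℓM : FrobEqFrobInfty W K q ℓ)
    (w : HeightOneSpectrum (𝓞 K)) [w.asIdeal.LiesOver v.asIdeal] (hf : w.asIdeal.inertiaDeg (𝓞 ℚ) = 2)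
    {Z : galoisCohomology (W.torsionGaloisModule (q : ℤ)) 1} {cK cK' : galH1Torsion (W.baseChange K) (q : ℤ)}
    (hZ : resTorsion W K (q : ℤ) Z = cK')
    (hRel₁ : ((2 ^ 1 : ℕ) : ℤ) • cK' ∈ (W.baseChange K).torsionLocalKer (w.adicCompletion K) (q : ℤ) ↔
      ((2 ^ 1 : ℕ) : ℤ) • cK ∈ (W.baseChange K).torsionLocalKer (w.adicCompletion K) (q : ℤ))
    (hcK : (2 : ℤ) • cK = 0) :
    galoisCohomology.localization (W.torsionGaloisModule (q : ℤ)) (Sum.inr v) 1 ((2 : ℕ) • Z) = 0 := by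
  have h2 : ((2 ^ 1 : ℕ) : ℤ) = 2 := by norm_num
  rw [h2] at hRel₁
  have hK0 : (2 : ℤ) • cK ∈ (W.baseChange K).torsionLocalKer (w.adicCompletion K) (q : ℤ) := by
    rw [hcK]; exact AddSubgroup.zero_mem _
  have hv2 : (2 : ℤ) • Z ∈ W.torsionLocalKer (v.adicCompletion ℚ) (q : ℤ) := by
    have h := hRel₁.mpr hK0
    rw [← hZ] at h
    exact (zsmul_mem_torsionLocalKer_iff_resTorsion_of_notMem W hΔ hM hq hℓ hℓ2 hℓv hgood h2K hθ hc hcv hℓM w hf Z 2).mpr h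
  rw [← ofNat_zsmul]
  exact localization_zsmul_eq_zero_of_mem_torsionLocalKer W q v Z 2 hv2

end Rat

end Summit.BirchSwinnertonDyer.BirchSwinnertonDyer.Theorems.GenusExact.RelaxedCount

end
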